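import Literature.AnabelianGeometry.EtaleTheta.Discharge.Sec1ThetaOrbitModelChi
import Literature.AnabelianGeometry.EtaleTheta.StandardDataModelNonVacuity
import Literature.AnabelianGeometry.EtaleTheta.Thm110HypothesisRefl
import Literature.AnabelianGeometry.EtaleTheta.Discharge.Sec1Thm110iUniqueSchemaCriterion
import Literature.AnabelianGeometry.EtaleTheta.Discharge.Sec1Thm110iiSchemaCriterion
import HarnessLib

/-!
# [EtTh] Thm. 1.10 (i)/(ii) as TYPED: the universal closures of `Thm110iUnique` (F-0513), `Thm110i` (F-0512)
# and `Thm110ii` (F-0514) are FALSE — decided at the Kummer-carrying χ-model `MuTwoSetting.modelχ` (PROOF-ONLY)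

S. Mochizuki, *The étale theta function and its Frobenioid-theoretic manifestations*, Publ. RIMS **45** (2009)
[EtTh], §1, Def. 1.9 / Thm. 1.10 (i), (ii), PRIMS PDF pp. 29–30 (printed 255–256) [cite: MochizukiEtTh2009, Thm 1.10 (i) p.29]:
"√−1 determines a 4-torsion point τ", "η̈^{Θ,Z}|_τ, η̈^{Θ,Z}|_{τ⁻¹} … standard set of values", "of standard
type", "determines this collection of classes up to multiplication by ±1", "(ii) … preserves the standard sets of
values". Layer L2 of the abc-iut cell, block F tranche 113 (seat abc-iut-f-113 gen 3; FACT-LIST rows F-0513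
`Thm110iUnique`, F-0512 `Thm110i`, and — released to this seat by abc-iut-f-114 gen 4 — F-0514 `Thm110ii`), R78
cluster hand F8 step 2b. PROOF-ONLY over the orbit lemma `Discharge/Sec1ThetaOrbitModelChi` (this seat),
`SettingModelChiMuTwo` (F8: `MuTwoSetting.modelχ`, `epsZχ`, `modelχ_isAdmissibleEpsZ`), abc-iut-L2-t6's
`SettingModelChiSectionPoints` / `SettingModelChiAnchoredPoints` (F7b: `etaleThetaDataχSec`, `onePlusP`,
`onePlusP_ne_cusp`, `norm_one_add_natCast_p`, `anchoredPointχ`, `coord_anchoredPointχ`), abc-iut-w5-d008's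
`Padic.exists_sq_eq_neg_one` / `Padic.norm_eq_one_of_sq_eq_neg_one`, abc-iut-L6-t12's `Thm110Hypothesis.nonempty_refl`,
the gen-2 criteria of this base (`MuTwoSetting.not_thm110iUnique_of_minimal_values`, `not_thm110i_of_minimal_values`,
p433898) and abc-iut-f-114's `not_forall_thm110ii_of_exists` (p434872) — all consumed BY NAME; no `def`, no instance.

THE TEST (gen-0's «twisted `τ⁻¹`» recipe, kernel form). For `p ≡ 1 (mod 4)` (`√−1 ∈ ℚ_p`) take
`u := 1 + p ∈ O^×_K̈`, `η̈ := infl κ̈(u⁻¹) · infl log(Ü)` (singleton `η̈^{Θ,Z}`-orbit for `ε_Z := a`), `τ :=` L2-t6's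
anchored section-point of parameter `u` RE-COORDINATISED to `√−1`, `τ⁻¹ :=` the one of parameter `u²` re-coordinatised
to `(√−1)⁻¹` — legitimate `StandardData`, because the typed Def. 1.9 leaves `coord` FREE next to `(D_y, evalAt)`
(K2 NOTE N1; the anchored repair `AnchoredStandardData` is abc-iut-L2-t1's p421374). Then `V(η̈, τ) = {1}`,
`V(η̈, τ⁻¹) = {u}` (`exists_standardData_valuesAt_modelχ`), so `η̈` AND `(u⁻¹·η̈)` are of standard type with
`(1+p)^{∓1} ≠ ±1`: **`not_thm110iUnique_modelχ`** (F-0513); at the identity hypothesis with `S_β := (A_{u²}, A_{u²})`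
**`not_thm110i_modelχ`** (F-0512); two standard data with `τ`-value sets `{1} ≠ {u}`: **`not_forall_thm110ii_modelχ`**
(F-0514). ABSOLUTE FORMS at `p = 5`: **`not_forall_thm110iUnique`**, **`not_forall_thm110i`**, **`not_forall_thm110ii`**
— the literal universal closures of the three FACT-LIST rows are FALSE in the kernel.

HONEST FRAMING: these refute OUR ∀-closures of OUR typed schemata at OUR semi-synthetic model (free `coord`,
evaluation free up to the Kummer retraction); they say NOTHING about [EtTh] Thm. 1.10 on actual curves, where
`Ü(τ^{±1}) = √−1^{±1}` is the value of a function and Prop. 1.4 (ii) ties the values at `τ`, `τ⁻¹` — the K2 routes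
(abc-iut-w5-d140, r8″ / `thm110_i_ii_iii_of_namedInputs`) prove the REPAIRED statements over `AnchoredStandardData`.
Typed ≠ proved; refuting a typed closure ≠ refuting print; no side is taken on [IUTchIII] Cor. 3.12 or on any author.
-/

noncomputable section

namespace Literature.AnabelianGeometry.EtaleTheta.SettingModel

open Literature.AnabelianGeometry.SemiGraphs _root_.Function

variable (p : ℕ) [Fact p.Prime]

/-! ### (C) The data: `√−1 ∈ ℚ_p` (`p ≡ 1 mod 4`), units off the cusps, re-coordinatised anchored points -/

/-- A unit `w` of `ℚ̄_p` with `w ≠ ±1` is off the cusps `±q̈^ℤ = ±p^ℤ` of the χ-model (a power of `p` of norm `1` is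
`p⁰`). [cite: MochizukiEtTh2009, Prop 1.4 (i) p.21] -/
theorem ne_cusp_modelχ_of_norm_eq_one {w : PadicAlgCl p} (hw : ‖w‖ = 1) (h1 : w ≠ 1) (h2 : w ≠ -1) (a : ℤ) :
    w ≠ (ThetaSetting.modelχ p).qdd ^ a ∧ w ≠ -((ThetaSetting.modelχ p).qdd ^ a) := by
  change w ≠ ((p : ℕ) : PadicAlgCl p) ^ a ∧ w ≠ -(((p : ℕ) : PadicAlgCl p) ^ a)
  have hp : ‖(p : PadicAlgCl p)‖ < 1 := by
    rw [← map_natCast (algebraMap ℚ_[p] (PadicAlgCl p)) p, PadicAlgCl.norm_extends]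
    exact Padic.norm_p_lt_one
  have hzero : ‖((p : ℕ) : PadicAlgCl p) ^ a‖ = 1 → a = 0 := fun h => by
    rw [norm_zpow] at h
    exact (zpow_eq_one_iff_right₀ (norm_nonneg _) hp.ne).mp h
  constructor
  · intro h
    have hn : ‖((p : ℕ) : PadicAlgCl p) ^ a‖ = 1 := by rw [← h]; exact hw
    rw [hzero hn, zpow_zero] at h
    exact h1 h
  · intro h
    have hn : ‖((p : ℕ) : PadicAlgCl p) ^ a‖ = 1 := by rw [← norm_neg, ← h]; exact hw
    rw [hzero hn, zpow_zero] at h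
    exact h2 h

/-- `(1 + p)² ∈ K̈^×` is off the cusps. [cite: MochizukiEtTh2009, Prop 1.4 (i) p.21] -/
theorem onePlusP_sq_ne_cusp (a : ℤ) :
    (((onePlusP p ^ 2 : (↥(ThetaSetting.modelχ p).Kdd)ˣ) : (ThetaSetting.modelχ p).Kdd) : PadicAlgCl p) ≠
        (ThetaSetting.modelχ p).qdd ^ a ∧
      (((onePlusP p ^ 2 : (↥(ThetaSetting.modelχ p).Kdd)ˣ) : (ThetaSetting.modelχ p).Kdd) : PadicAlgCl p) ≠
        -((ThetaSetting.modelχ p).qdd ^ a) := by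
  have hcoe : (((onePlusP p ^ 2 : (↥(ThetaSetting.modelχ p).Kdd)ˣ) : (ThetaSetting.modelχ p).Kdd) : PadicAlgCl p) =
      ((1 : PadicAlgCl p) + (p : PadicAlgCl p)) ^ 2 := by
    rw [Units.val_pow_eq_pow_val]; push_cast; rw [coe_onePlusP]
  rw [hcoe]
  refine ne_cusp_modelχ_of_norm_eq_one p (by rw [norm_pow, norm_one_add_natCast_p, one_pow]) ?_ ?_ a
  · intro h
    have h2 : (((1 + p) ^ 2 : ℕ) : PadicAlgCl p) = ((1 : ℕ) : PadicAlgCl p) := by push_cast; rw [h]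
    have h3 := Nat.cast_injective h2
    nlinarith [(Fact.out : p.Prime).two_le]
  · intro h
    have h2 : (((1 + p) ^ 2 + 1 : ℕ) : PadicAlgCl p) = 0 := by push_cast; rw [h]; ring
    exact Nat.cast_ne_zero.mpr (by positivity) h2

/-- `1 + p ≠ ±1` (the χ-model's `1 + p` is a unit of `O_K̈` other than `±1`). [cite: MochizukiEtTh2009, Prop 1.4 (i) p.21] -/
theorem coe_onePlusP_ne_one_and_ne_neg_one :
    ((onePlusP p : (ThetaSetting.modelχ p).Kdd) : PadicAlgCl p) ≠ 1 ∧
      ((onePlusP p : (ThetaSetting.modelχ p).Kdd) : PadicAlgCl p) ≠ -1 := by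
  have h := onePlusP_ne_cusp p 0
  rwa [zpow_zero] at h

/-- `1 + p ∈ O^×_K̈`. [cite: MochizukiEtTh2009, §1 p.17] -/
theorem onePlusP_mem_unitsOKdd : onePlusP p ∈ (ThetaSetting.modelχ p).unitsOKdd := by
  change ‖((onePlusP p : (ThetaSetting.modelχ p).Kdd) : PadicAlgCl p)‖ = 1
  rw [coe_onePlusP]
  exact norm_one_add_natCast_p p

/-- `(1 + p)⁻¹ ∈ O^×_K̈`. [cite: MochizukiEtTh2009, §1 p.17] -/
theorem onePlusP_inv_mem_unitsOKdd : (onePlusP p)⁻¹ ∈ (ThetaSetting.modelχ p).unitsOKdd :=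
  (ThetaSetting.modelχ p).unitsOKdd.inv_mem (onePlusP_mem_unitsOKdd p)

/-- `1 + p ≠ (1 + p)⁻¹·(±1)`-type bookkeeping: `(1+p) ≠ ±1` read on the unit `u⁻¹ · u²`. [folklore] -/
private theorem inv_mul_sq_onePlusP : (onePlusP p)⁻¹ * onePlusP p ^ 2 = onePlusP p := by
  rw [pow_two, inv_mul_cancel_left]

/-! ### (D) The three tests at `MuTwoSetting.modelχ` for `√−1 ∈ ℚ_p` -/

/-- **THE TEST DATA** (for a square root `x` of `−1` in `ℚ_p`): over the étale theta datum
`E := etaleThetaDataχSec p η̈` with `η̈ := infl κ̈(u⁻¹) · infl log(Ü)`, `u := 1 + p`, there are two Def. 1.9 standard data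
`S₁ = (τ := A_u ↦ √−1, τ⁻¹ := A_{u²} ↦ (√−1)⁻¹)` and `S₂ = (A_{u²} ↦ √−1, A_{u²} ↦ (√−1)⁻¹)` (L2-t6's anchored
section-points RE-COORDINATISED) whose standard sets of values for `ε_Z := a` are the singletons
`{1}`, `{u}`, `{u}`, `{u}`. [cite: MochizukiEtTh2009, Def 1.9 p.29] -/
theorem exists_standardData_valuesAt_modelχ {x : ℚ_[p]} (hx : x ^ 2 = -1) :
    ∃ (E : (ThetaSetting.modelχ p).EtaleThetaData)
      (S₁ S₂ : (MuTwoSetting.modelχ p).StandardData E.toKummerData),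
      ThetaSetting.Prop15ii E.toKummerData (ThetaSetting.modelχ p).compat ∧
      MuTwoSetting.valuesAt (M := MuTwoSetting.modelχ p) (ThetaSetting.modelχ p).compat (epsZχ p) E.etaDd S₁.tau =
          {1} ∧
        MuTwoSetting.valuesAt (M := MuTwoSetting.modelχ p) (ThetaSetting.modelχ p).compat (epsZχ p) E.etaDd
            S₁.tauInv = {onePlusP p} ∧
        MuTwoSetting.valuesAt (M := MuTwoSetting.modelχ p) (ThetaSetting.modelχ p).compat (epsZχ p) E.etaDd
            S₂.tau = {onePlusP p} ∧
        MuTwoSetting.valuesAt (M := MuTwoSetting.modelχ p) (ThetaSetting.modelχ p).compat (epsZχ p) E.etaDd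
            S₂.tauInv = {onePlusP p} := by
  -- the square root of `−1` in `K = K̈ = ℚ_p ⊆ ℚ̄_p`, as a unit of `K̈`
  set i : PadicAlgCl p := algebraMap ℚ_[p] (PadicAlgCl p) x with hi
  have hi2 : i ^ 2 = -1 := by rw [hi, ← map_pow, hx, map_neg, map_one]
  have hibot : i ∈ (⊥ : IntermediateField ℚ_[p] (PadicAlgCl p)) := IntermediateField.mem_bot.2 ⟨x, rfl⟩
  have hiKdd : i ∈ (ThetaSetting.modelχ p).Kdd :=
    (bot_le : (⊥ : IntermediateField ℚ_[p] (PadicAlgCl p)) ≤ (ThetaSetting.modelχ p).Kdd) hibot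
  have hi0 : i ≠ 0 := fun h => by
    rw [h, zero_pow two_ne_zero] at hi2
    exact one_ne_zero (neg_eq_zero.1 hi2.symm)
  have hinorm : ‖i‖ = 1 := by rw [hi, PadicAlgCl.norm_extends]; exact Padic.norm_eq_one_of_sq_eq_neg_one hx
  have htwo : (1 : PadicAlgCl p) ≠ -1 := fun h => two_ne_zero (α := PadicAlgCl p) (by linear_combination h)
  have hi1 : i ≠ 1 := fun h => by rw [h, one_pow] at hi2; exact htwo hi2
  have hin1 : i ≠ -1 := fun h => by rw [h, neg_one_sq] at hi2; exact htwo hi2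
  have hiinv1 : i⁻¹ ≠ 1 := fun h => hi1 (inv_eq_one.1 h)
  have hiinvn1 : i⁻¹ ≠ -1 := fun h => hin1 (by rw [← inv_inv i, h, inv_neg, inv_one])
  let iU : (↥(ThetaSetting.modelχ p).Kdd)ˣ := Units.mk0 ⟨i, hiKdd⟩ fun h => hi0 (congrArg Subtype.val h)
  have hiU : ((iU : (ThetaSetting.modelχ p).Kdd) : PadicAlgCl p) = i := rfl
  have hiUinv : (((iU⁻¹ : (↥(ThetaSetting.modelχ p).Kdd)ˣ) : (ThetaSetting.modelχ p).Kdd) : PadicAlgCl p) = i⁻¹ := by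
    rw [Units.val_inv_eq_inv_val]; push_cast; rw [hiU]
  -- the anchored section-points of parameters `u`, `u²`
  set u := onePlusP p with hu
  let Au : ThetaSetting.AnchoredPoint (kummerDataχSec p) := anchoredPointχ p u (onePlusP_ne_cusp p)
  let Au2 : ThetaSetting.AnchoredPoint (kummerDataχSec p) := anchoredPointχ p (u ^ 2) (onePlusP_sq_ne_cusp p)
  -- the test class
  set η : (ThetaSetting.modelχ p).H1 (ThetaSetting.modelχ p).GtpYdd :=
    (ThetaSetting.modelχ p).inflTheta (ThetaSetting.modelχ p).GtpYdd
        ((kummerDataχSec p).kumYdd ((kummerDataχSec p).toKddHat u⁻¹)) *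
      (ThetaSetting.modelχ p).inflTheta (ThetaSetting.modelχ p).GtpYdd (kummerDataχSec p).logUdd with hη
  have horb : (MuTwoSetting.modelχ p).thetaOrbit (ThetaSetting.modelχ p).compat (epsZχ p) η = {η} :=
    thetaOrbit_testClass p (ThetaSetting.modelχ p).compat u⁻¹
  -- re-coordinatised points
  let τ₁ : ThetaSetting.NonCuspidalPoint (kummerDataχSec p) :=
    { Au.toNonCuspidalPoint with
      coord := iU
      coord_ne_cusp := fun a => by rw [hiU]; exact ne_cusp_modelχ_of_norm_eq_one p hinorm hi1 hin1 a }
  let τ₂ : ThetaSetting.NonCuspidalPoint (kummerDataχSec p) :=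
    { Au2.toNonCuspidalPoint with
      coord := iU⁻¹
      coord_ne_cusp := fun a => by
        rw [hiUinv]; exact ne_cusp_modelχ_of_norm_eq_one p (by rw [norm_inv, hinorm, inv_one]) hiinv1 hiinvn1 a }
  let τ₃ : ThetaSetting.NonCuspidalPoint (kummerDataχSec p) :=
    { Au2.toNonCuspidalPoint with
      coord := iU
      coord_ne_cusp := fun a => by rw [hiU]; exact ne_cusp_modelχ_of_norm_eq_one p hinorm hi1 hin1 a }
  -- their values
  have hv₁ : τ₁.evalAt (ContH1.res (ThetaSetting.modelχ p).toTheta (ThetaSetting.modelχ p).DeltaTheta τ₁.Dpt_le η) =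
      (kummerDataχSec p).toKddHat 1 := by
    have h := evalAt_testClass p Au u⁻¹
    rw [coord_anchoredPointχ, inv_mul_cancel] at h
    exact h
  have hv₂ : τ₂.evalAt (ContH1.res (ThetaSetting.modelχ p).toTheta (ThetaSetting.modelχ p).DeltaTheta τ₂.Dpt_le η) =
      (kummerDataχSec p).toKddHat u := by
    have h := evalAt_testClass p Au2 u⁻¹
    rw [coord_anchoredPointχ, inv_mul_sq_onePlusP] at h
    exact h
  have hv₃ : τ₃.evalAt (ContH1.res (ThetaSetting.modelχ p).toTheta (ThetaSetting.modelχ p).DeltaTheta τ₃.Dpt_le η) =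
      (kummerDataχSec p).toKddHat u := by
    have h := evalAt_testClass p Au2 u⁻¹
    rw [coord_anchoredPointχ, inv_mul_sq_onePlusP] at h
    exact h
  refine ⟨etaleThetaDataχSec p η,
    { sqrtNegOne := i, sqrtNegOne_mem := hibot, sqrtNegOne_sq := hi2, tau := τ₁, tauInv := τ₂,
      tau_coord := hiU, tauInv_coord := hiUinv },
    { sqrtNegOne := i, sqrtNegOne_mem := hibot, sqrtNegOne_sq := hi2, tau := τ₃, tauInv := τ₂,
      tau_coord := hiU, tauInv_coord := hiUinv }, prop15ii_kummerDataχSec p _, ?_, ?_, ?_, ?_⟩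
  · exact valuesAt_eq_singleton_of_thetaOrbit_eq p _ _ horb τ₁ hv₁
  · exact valuesAt_eq_singleton_of_thetaOrbit_eq p _ _ horb τ₂ hv₂
  · exact valuesAt_eq_singleton_of_thetaOrbit_eq p _ _ horb τ₃ hv₃
  · exact valuesAt_eq_singleton_of_thetaOrbit_eq p _ _ horb τ₂ hv₂

/-- `1 ≠ 1 + p` as units of `K̈`. [folklore] -/
private theorem one_ne_onePlusP : (1 : (↥(ThetaSetting.modelχ p).Kdd)ˣ) ≠ onePlusP p := fun h =>
  (coe_onePlusP_ne_one_and_ne_neg_one p).1 (by rw [← h]; simp)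

/-- **F-0513 `Thm110iUnique` FAILS at `MuTwoSetting.modelχ`** (for `√−1 ∈ ℚ_p`): with `ε_Z := a` (admissible),
`E := etaleThetaDataχSec p η̈`, `S := S₁`, both `η̈^{Θ,Z}` (minimal value `1` at `τ`) and `(u⁻¹·η̈)^{Θ,Z}` (minimal value
`1` at `τ⁻¹`) are of standard type although `u⁻¹ = (1+p)⁻¹ ≠ ±1` — the gen-2 refutation shape
`MuTwoSetting.not_thm110iUnique_of_minimal_values`, (V2′) supplied by Prop. 1.5 (ii) at the section datum.
[cite: MochizukiEtTh2009, Thm 1.10 (i) p.29] -/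
theorem not_thm110iUnique_modelχ {x : ℚ_[p]} (hx : x ^ 2 = -1) :
    ∃ (E : (ThetaSetting.modelχ p).EtaleThetaData) (S : (MuTwoSetting.modelχ p).StandardData E.toKummerData),
      ¬ Thm110iUnique (M := MuTwoSetting.modelχ p) (ThetaSetting.modelχ p).compat
          (MuTwoSetting.modelχ_isAdmissibleEpsZ p) E S := by
  obtain ⟨E, S₁, S₂, h15, h1, h2, -, -⟩ := exists_standardData_valuesAt_modelχ p hx
  refine ⟨E, S₁, MuTwoSetting.not_thm110iUnique_of_minimal_values (M := MuTwoSetting.modelχ p)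
    (ThetaSetting.modelχ p).compat (MuTwoSetting.modelχ_isAdmissibleEpsZ p) E S₁
    (thm110UnitClassEquivariance_of_prop15ii (M := MuTwoSetting.modelχ p) _ (epsZχ p) h15)
    (y₁ := S₁.tau) (Or.inl rfl) (m₁ := 1) (by rw [h1]; exact Set.mem_singleton _)
    (fun w hw => by rw [h1, Set.mem_singleton_iff] at hw; rw [hw]) (Or.inl (by simp))
    (y₂ := S₁.tauInv) (Or.inr rfl) (m₂ := onePlusP p) (by rw [h2]; exact Set.mem_singleton _)
    (fun w hw => by rw [h2, Set.mem_singleton_iff] at hw; rw [hw]) (onePlusP_mem_unitsOKdd p)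
    (coe_onePlusP_ne_one_and_ne_neg_one p).1 (coe_onePlusP_ne_one_and_ne_neg_one p).2⟩

/-- **F-0512 `Thm110i` FAILS at `MuTwoSetting.modelχ`** (for `√−1 ∈ ℚ_p`), already at the IDENTITY hypothesis
`γ = id` (abc-iut-L6-t12's `Thm110Hypothesis.nonempty_refl`): `S_α := S₁` makes `η̈^{Θ,Z}` of standard type (value
`1` at `τ`), `S_β := S₂` does not (all minimal values equal `u = 1 + p ≠ ±1`) — the gen-2 shape
`not_thm110i_of_minimal_values`. [cite: MochizukiEtTh2009, Thm 1.10 (i) p.29] -/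
theorem not_thm110i_modelχ {x : ℚ_[p]} (hx : x ^ 2 = -1) :
    ∃ (E : (ThetaSetting.modelχ p).EtaleThetaData)
      (H : Thm110Hypothesis (Mα := MuTwoSetting.modelχ p) (Mβ := MuTwoSetting.modelχ p) (epsZχ p) (epsZχ p)
        (ThetaSetting.modelχ p).compat (ThetaSetting.modelχ p).compat E E
        (ContinuousMulEquiv.refl ((MuTwoSetting.modelχ p).dotC (epsZχ p))))
      (Sα Sβ : (MuTwoSetting.modelχ p).StandardData E.toKummerData), ¬ Thm110i H Sα Sβ := by
  obtain ⟨E, S₁, S₂, -, h1, -, h3, h4⟩ := exists_standardData_valuesAt_modelχ p hx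
  obtain ⟨H⟩ := MuTwoSetting.Thm110Hypothesis.nonempty_refl (MuTwoSetting.modelχ p)
    (MuTwoSetting.modelχ_isAdmissibleEpsZ p) (ThetaSetting.modelχ p).compat E
  refine ⟨E, H, S₁, S₂, not_thm110i_of_minimal_values H S₁ S₂ (y := S₁.tau) (Or.inl rfl) (m := 1)
    (by rw [h1]; exact Set.mem_singleton _) (fun w hw => by rw [h1, Set.mem_singleton_iff] at hw; rw [hw])
    (Or.inl (by simp)) ?_⟩
  rintro y' (rfl | rfl) m' hm' -
  · rw [h3, Set.mem_singleton_iff] at hm'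
    rw [hm']
    exact coe_onePlusP_ne_one_and_ne_neg_one p
  · rw [h4, Set.mem_singleton_iff] at hm'
    rw [hm']
    exact coe_onePlusP_ne_one_and_ne_neg_one p

/-- **The ∀-closure of F-0514 `Thm110ii` FAILS** over `MuTwoSetting p` for `√−1 ∈ ℚ_p`: `S₁`, `S₂` over ONE Kummer-
carrying setting have different `τ`-value sets (`{1}` vs `{u}`), so abc-iut-f-114's `not_forall_thm110ii_of_exists`
fires. [cite: MochizukiEtTh2009, Thm 1.10 (ii) p.30] -/
theorem not_forall_thm110ii_modelχ {x : ℚ_[p]} (hx : x ^ 2 = -1) :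
    ¬ ∀ (Mα Mβ : MuTwoSetting p) (εα : Mα.GtpC) (εβ : Mβ.GtpC) (hCα : Mα.toThetaSetting.Compat)
        (hCβ : Mβ.toThetaSetting.Compat) (Eα : Mα.toThetaSetting.EtaleThetaData)
        (Eβ : Mβ.toThetaSetting.EtaleThetaData) (γ : Mα.dotC εα ≃ₜ* Mβ.dotC εβ)
        (H : Thm110Hypothesis εα εβ hCα hCβ Eα Eβ γ) (Sα : Mα.StandardData Eα.toKummerData)
        (Sβ : Mβ.StandardData Eβ.toKummerData), Thm110ii H Sα Sβ := by
  obtain ⟨E, S₁, S₂, -, h1, -, h3, h4⟩ := exists_standardData_valuesAt_modelχ p hx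
  refine not_forall_thm110ii_of_exists ⟨MuTwoSetting.modelχ p, epsZχ p, MuTwoSetting.modelχ_isAdmissibleEpsZ p,
    (ThetaSetting.modelχ p).compat, E, S₁, S₂, ?_, ?_⟩
  · rw [h1, h3]
    exact fun h => one_ne_onePlusP p (Set.singleton_eq_singleton_iff.1 h)
  · rw [h1, h4]
    exact fun h => one_ne_onePlusP p (Set.singleton_eq_singleton_iff.1 h)

/-! ### (E) `p ≡ 1 (mod 4)` and the ABSOLUTE forms: the three universal closures are FALSE -/

/-- F-0513 fails at `MuTwoSetting.modelχ p` whenever `p ≡ 1 (mod 4)` (`√−1 ∈ ℚ_p`, abc-iut-w5-d008's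
`Padic.exists_sq_eq_neg_one`). [cite: MochizukiEtTh2009, Thm 1.10 (i) p.29] -/
theorem not_thm110iUnique_modelχ_of_mod_four (hp : p % 4 = 1) :
    ∃ (E : (ThetaSetting.modelχ p).EtaleThetaData) (S : (MuTwoSetting.modelχ p).StandardData E.toKummerData),
      ¬ Thm110iUnique (M := MuTwoSetting.modelχ p) (ThetaSetting.modelχ p).compat
          (MuTwoSetting.modelχ_isAdmissibleEpsZ p) E S := by
  obtain ⟨x, hx⟩ := Padic.exists_sq_eq_neg_one hp
  exact not_thm110iUnique_modelχ p hx

/-- F-0512 fails at `MuTwoSetting.modelχ p` whenever `p ≡ 1 (mod 4)`. [cite: MochizukiEtTh2009, Thm 1.10 (i) p.29] -/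
theorem not_thm110i_modelχ_of_mod_four (hp : p % 4 = 1) :
    ∃ (E : (ThetaSetting.modelχ p).EtaleThetaData)
      (H : Thm110Hypothesis (Mα := MuTwoSetting.modelχ p) (Mβ := MuTwoSetting.modelχ p) (epsZχ p) (epsZχ p)
        (ThetaSetting.modelχ p).compat (ThetaSetting.modelχ p).compat E E
        (ContinuousMulEquiv.refl ((MuTwoSetting.modelχ p).dotC (epsZχ p))))
      (Sα Sβ : (MuTwoSetting.modelχ p).StandardData E.toKummerData), ¬ Thm110i H Sα Sβ := by
  obtain ⟨x, hx⟩ := Padic.exists_sq_eq_neg_one hp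
  exact not_thm110i_modelχ p hx

/-- The F-0514 closure fails over `MuTwoSetting p` whenever `p ≡ 1 (mod 4)`. [cite: MochizukiEtTh2009, Thm 1.10 (ii) p.30] -/
theorem not_forall_thm110ii_modelχ_of_mod_four (hp : p % 4 = 1) :
    ¬ ∀ (Mα Mβ : MuTwoSetting p) (εα : Mα.GtpC) (εβ : Mβ.GtpC) (hCα : Mα.toThetaSetting.Compat)
        (hCβ : Mβ.toThetaSetting.Compat) (Eα : Mα.toThetaSetting.EtaleThetaData)
        (Eβ : Mβ.toThetaSetting.EtaleThetaData) (γ : Mα.dotC εα ≃ₜ* Mβ.dotC εβ)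
        (H : Thm110Hypothesis εα εβ hCα hCβ Eα Eβ γ) (Sα : Mα.StandardData Eα.toKummerData)
        (Sβ : Mβ.StandardData Eβ.toKummerData), Thm110ii H Sα Sβ := by
  obtain ⟨x, hx⟩ := Padic.exists_sq_eq_neg_one hp
  exact not_forall_thm110ii_modelχ p hx

end Literature.AnabelianGeometry.EtaleTheta.SettingModel

namespace Literature.AnabelianGeometry.EtaleTheta

open Literature.AnabelianGeometry.EtaleTheta.SettingModel

/-- `5` is prime. [folklore] -/
private theorem fact_prime_five : Fact (Nat.Prime 5) := ⟨by norm_num⟩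

/-- **THE UNIVERSAL CLOSURE OF F-0513 `Thm110iUnique` IS FALSE** (absolute form, `p = 5`, `5 ≡ 1 mod 4`): the
typed second clause of [EtTh] Thm. 1.10 (i) does not hold for every `MuTwoSetting`, `Compat`, admissible `ε_Z`,
étale theta datum and Def. 1.9 standard datum — SCHEMA-REFUTED at a Kummer-carrying model. (Refutes OUR closure of
OUR schema; print's statement concerns actual curves; the REPAIRED statement over `AnchoredStandardData` is K2's.)
[cite: MochizukiEtTh2009, Thm 1.10 (i) p.29] -/
theorem not_forall_thm110iUnique :
    ¬ ∀ (p : ℕ) [Fact p.Prime] (M : MuTwoSetting p) (hC : M.toThetaSetting.Compat) (εZ : M.GtpC)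
        (hZ : M.IsAdmissibleEpsZ εZ) (E : M.toThetaSetting.EtaleThetaData) (S : M.StandardData E.toKummerData),
        Thm110iUnique hC hZ E S := by
  intro h
  haveI := fact_prime_five
  obtain ⟨E, S, hS⟩ := not_thm110iUnique_modelχ_of_mod_four 5 (by norm_num)
  exact hS (h 5 (MuTwoSetting.modelχ 5) _ _ _ E S)

/-- **THE UNIVERSAL CLOSURE OF F-0512 `Thm110i` IS FALSE** (absolute form, `p = 5`).
[cite: MochizukiEtTh2009, Thm 1.10 (i) p.29] -/
theorem not_forall_thm110i :
    ¬ ∀ (p : ℕ) [Fact p.Prime] (Mα Mβ : MuTwoSetting p) (εα : Mα.GtpC) (εβ : Mβ.GtpC)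
        (hCα : Mα.toThetaSetting.Compat) (hCβ : Mβ.toThetaSetting.Compat)
        (Eα : Mα.toThetaSetting.EtaleThetaData) (Eβ : Mβ.toThetaSetting.EtaleThetaData)
        (γ : Mα.dotC εα ≃ₜ* Mβ.dotC εβ) (H : Thm110Hypothesis εα εβ hCα hCβ Eα Eβ γ)
        (Sα : Mα.StandardData Eα.toKummerData) (Sβ : Mβ.StandardData Eβ.toKummerData), Thm110i H Sα Sβ := by
  intro h
  haveI := fact_prime_five
  obtain ⟨E, H, Sα, Sβ, hH⟩ := not_thm110i_modelχ_of_mod_four 5 (by norm_num)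
  exact hH (h 5 (MuTwoSetting.modelχ 5) (MuTwoSetting.modelχ 5) _ _ _ _ E E _ H Sα Sβ)

/-- **THE UNIVERSAL CLOSURE OF F-0514 `Thm110ii` IS FALSE** (absolute form, `p = 5`; abc-iut-f-114's criterion).
[cite: MochizukiEtTh2009, Thm 1.10 (ii) p.30] -/
theorem not_forall_thm110ii :
    ¬ ∀ (p : ℕ) [Fact p.Prime] (Mα Mβ : MuTwoSetting p) (εα : Mα.GtpC) (εβ : Mβ.GtpC)
        (hCα : Mα.toThetaSetting.Compat) (hCβ : Mβ.toThetaSetting.Compat)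
        (Eα : Mα.toThetaSetting.EtaleThetaData) (Eβ : Mβ.toThetaSetting.EtaleThetaData)
        (γ : Mα.dotC εα ≃ₜ* Mβ.dotC εβ) (H : Thm110Hypothesis εα εβ hCα hCβ Eα Eβ γ)
        (Sα : Mα.StandardData Eα.toKummerData) (Sβ : Mβ.StandardData Eβ.toKummerData), Thm110ii H Sα Sβ := by
  intro h
  haveI := fact_prime_five
  exact not_forall_thm110ii_modelχ_of_mod_four 5 (by norm_num) (h 5)

end Literature.AnabelianGeometry.EtaleTheta

end
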